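import Summits.Ventures.QEC.Census.CertCoverBatch
import Summits.Ventures.QEC.Census.BB.A1s_n192_k8_c6f27a3d.CoreDefs
import HarnessLib

set_option Elab.async false
set_option maxRecDepth 200000

/-!
# `[[192,8,16]]` one-level cover certificate of `A1s_n192_k8_c6f27a3d` — LEVEL-1→0 coset problems 0…24 (deep problems [1] excluded: `ProbDeep*.lean`) as COMPACT data
(`ProbData`: U, f, σ, y₀, allow; qec-type-10 `CertCoverBatch.mkCoset` rebuilds each `CosetProb` in the kernel) + their verdict
`probsOK cov covR hx hx1 D1 lxd 14` (one `decide +kernel`; 24 problems, depths f=0:15 f=1:5 f=2:4 f=3:0, est. 252.5 s).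
qec-search-1 g5 (pattern of search-9 g5 `Probs*`); data from JSON `level10.problems` (sha256 07f726b4246ab47f…). Data + decided check; KERNEL.
-/

namespace Summit.Ventures.QEC.Census.A1s_n192_k8_c6f27a3d

open Matrix Summit.Ventures.QEC.Census Literature.InformationTheory.QuantumCodes

/-- Problems 0…24 (24): `⟨U, f, σ, y₀, allow⟩`. -/
def probs00 : List ProbData := [
    ⟨360642013745381389, 1, 201326912, 12, [0]⟩,
    ⟨4869947333863996456960, 2, 402788353, 147574093327165292544, [0, 39614081257132168796771975168]⟩,
    ⟨4943730863224240504832, 0, 201529345, 221360999253259583488, [0]⟩,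
    ⟨5017541414182290980864, 2, 270339, 4722393509002937106432, [0, 9444732965739290427392]⟩,
    ⟨5607864255209759309825, 0, 17588277, 4722420539671697686528, [0]⟩,
    ⟨14167121966607135801344, 2, 0, 0, [0, 9007199254740992]⟩,
    ⟨23611899968342725361665, 1, 16777264, 4722379993668548427777, [0]⟩,
    ⟨23759467308538172342273, 0, 419565617, 19037094068001341177856, [0]⟩,
    ⟨23907025360059448950785, 0, 17047603, 23611877454880095076352, [0]⟩,
    ⟨24202150751776104906752, 0, 540678, 23611854941417397157888, [0]⟩,
    ⟨24792545650397670408194, 0, 34635884, 5902971614385955536898, [0]⟩,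
    ⟨33056605912484293771265, 0, 16777264, 1, [0]⟩,
    ⟨33351767332997951913985, 1, 17047603, 14167099453144421105665, [0]⟩,
    ⟨33646874710316098387968, 1, 540678, 33056578899957390639104, [0]⟩,
    ⟨33794442050511542222848, 0, 403329031, 28481772999616007503872, [0]⟩,
    ⟨34532413015052903251970, 0, 34906223, 19184721941191066648576, [0]⟩,
    ⟨42501419943016902295554, 1, 33554528, 2, [0]⟩,
    ⟨42538201699350896730144, 0, 50365449, 4722376066797143818304, []⟩,
    ⟨42796581363530642751490, 0, 33824867, 4722393509002937106434, [0]⟩,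
    ⟨43681957538680655183873, 0, 17858620, 5902971614385955536897, [0]⟩,
    ⟨44013932521006942994816, 0, 68428801, 42796446286259322683584, []⟩,
    ⟨52241287307672126750722, 2, 33824867, 14167099453144421105666, [0, 1048576]⟩,
    ⟨53716932280654028210176, 0, 1622026, 47223664855909364924416, [0]⟩,
    ⟨62276316092841095856130, 0, 34365541, 23611832427954682462210, [0]⟩]

set_option maxHeartbeats 400000000 in
/-- Every problem of this chunk passes (`mkCoset` elimination + `cosetOKD` + fast `σ` + depth + `BU`-evenness + label checks). -/
theorem probs00_ok : probsOK A1s_n192_k8_c6f27a3d.cov covR hx hx1 D1 lxd 14 probs00 = true := by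
  decide +kernel

/-- Pointwise form. -/
theorem probs00_all : ∀ x ∈ A1s_n192_k8_c6f27a3d.probs00, probOK cov covR hx hx1 D1 lxd 14 x = true := by
  have h := probs00_ok
  rwa [probsOK, List.all_eq_true] at h

end Summit.Ventures.QEC.Census.A1s_n192_k8_c6f27a3d
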